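import Literature.MathematicalPhysics.QuantumFieldTheory.Balaban1983to89.Node00.Record13SepCoPHChi
import Literature.MathematicalPhysics.QuantumFieldTheory.Balaban1983to89.Node00.Record13CoreChi

/-!
# NODE 00 — K0 σ-CLOSURE χ-EDITIONS, SECOND TRANCHE, FILE F2∪F3 (dag-lead g40 WORDS 58x HANDS-3 H3.1; RR-2 g26 INTENT T2; one leaf per D-0064): the
# `Stage13Params`-LEVEL AND `Stage13RParams`-LEVEL SEPARATED-RANGE Co-CLASS PROVISO STRUCTURES `Stage13Params.Provisos₁₃SepCoP` (`Node00/Record13SepCoP`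
# §1, v1.4) AND `Stage13RParams.Provisos₁₃SepCoPR` (`Node00/Record13SepCoPR` §1, v1.6 `R`) RE-ISSUED GENERIC IN THE β-SLOT χ —
# `Stage13Params.Provisos₁₃SepCoPChi θ χ` (+ `.toCore ∕ .odd_M ∕ .not_four_dvd_M ∕ .M₁_dvd_dCubeSide ∕ .wtLaws ∕ .tstep`), `Stage13RParams.Provisos₁₃SepCoPRChi θ χ`
# (+ the same faces) — with the field-wise receipts at `χ := chiβOfRecord₁₃ θ` and the RE-CENTRED instances `…SepCoPAx ∕ …SepCoPRAx` (`χ := chiβOfRecord₁₃Ax θ`)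

CITATION HEADER.  [III] = [Balaban1988Convergent] (CMP **119**) (1.11) p.248, (2.1) p.254, (2.7) p.255, (2.18) p.257, (2.21) p.258, (2.28) p.259,
(3.2)–(3.9) pp.265–266, (3.16) p.268, (3.20)–(3.21) p.269; [6] = [Balaban1985RegularSpaces] (1.3)–(1.9) pp.76–77, (7) p.278; [15] = [Balaban1985Variational]
Thm 1 (8) p.279; [IV] = [Balaban1989LargeFieldI] (0.3)–(0.4) p.176; [I] = [Balaban1987RG1] (0.13) p.254, (0.19) p.255, p.259, (1.2) p.260.  Every declaration
below is the VERBATIM body of the like-named declaration of `Node00/Record13SepCoP.lean` (:127–:235) ∕ `Node00/Record13SepCoPR.lean` (:64–:170) with EXACTLY the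
substitutions of [Ax-3b∕3c∕3d] (binder `(χ : ChiSlot F N)` after `θ`; `gOfRecord₁₃ ↦ gOfRecord₁₃Chi … χ`, `EOfRecord₁₃ ↦ EOfRecord₁₃Chi … χ`, `settingOfRecord₁₃ ↦
settingOfRecord₁₃Chi … χ`, `PartCompat₁₃ ↦ PartCompat₁₃Chi … χ`, `suppOfRecord₁₃SepCoP ↦ suppOfRecord₁₃SepCoPChi … χ` ([Ax-3d] :72), `UbgOfRecord₁₃CoP ↦ UbgOfRecord₁₃CoPChi … χ`
([Ax-3c]); `Provisos₁₃Core ↦ Provisos₁₃CoreChi` (F1 `Node00/Record13CoreChi`)) — [Ax-3d]'s `Stage13HParams.Provisos₁₃SepCoPHChi` (:84) is the `H`-level member of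
the same family; this leaf types the two levels BENEATH it that K0's ⁵→⁶→⁷ door road (`Record13SepCoPRInhabitedOfSepCoP`, `Record13SepCoPInhabitedOfThm1CCMGaugeR`)
and the separated live-selector sockets climb.  dag-n07-w3 g22's σ-closure table `SIGMA-CLOSURE-K0-V23-Ax.g22.md` (4ca252f7ab47910a), rows `Node00.Record13SepCoP`
(13 statement-level centred entries missing: the structure, `mk` and its centred rows) and `Node00.Record13SepCoPR` (15): all typed here.

Cell `pub-ymgap`, LADDER-YM R4 NODE 00, seat `pub-ymgap-node00-def-RR-2` g26.  `--kind definition --supports stmt-QuantumFields-27238` (K0ᴬ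
`Record13SepCoPHInhabitedAx` door supply; count-neutral).  PURELY ADDITIVE: a NEW leaf; the source modules and [Ax-3b∕c∕d] are NOT edited (CRIT-1 g33 terms (α):
body-freeze, new names only).

WHAT IS TYPED.
* §1 `structure Stage13Params.Provisos₁₃SepCoPChi (θ) (χ)` — the thirteen rows of `Provisos₁₃SepCoP` VERBATIM, same names, same order (`intPiece`, `measω`, `measChi`,
  `zetaUnity`, `zetaAbs`, `rstep`, `rzLaws`, `ztLaws`, `ztLocal`, `hM`, `hM₁`, `bg`, `zetaMeas` — `zetaMeas` a plain required row as in [Ax-3d] :84), row `bg` = def-R's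
  ranged background proviso `BgProvisoΛ` at `settingOfRecord₁₃Chi θ χ p`, `θ.Rz p.K`, over the separated (7)-regular support `suppOfRecord₁₃SepCoPChi θ χ p n` AT the
  Co-class background `UbgOfRecord₁₃CoPChi θ χ p n`, guarded by the window along `gOfRecord₁₃Chi θ χ p` and by `PartCompat₁₃Chi θ χ p n`; faces `.toCore` (to F1's
  `Provisos₁₃CoreChi`), `.odd_M`, `.not_four_dvd_M`, `.M₁_dvd_dCubeSide`, `.wtLaws`, `.tstep` (source :192–:235 verbatim).
* §2 `structure Stage13RParams.Provisos₁₃SepCoPRChi (θ) (χ)` — the thirteen rows of `Provisos₁₃SepCoPR` VERBATIM (as §1 with `zrLaws : ∀ p, (θ.Zr p).Laws` ∕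
  `zrLocal : ∀ p, (θ.Zr p).LocalLaws` in place of `ztLaws ∕ ztLocal`, every Record13-level object at `θ.toStage13Params`); faces `.odd_M`, `.not_four_dvd_M`,
  `.M₁_dvd_dCubeSide`, `.wtLaws`, `.tstep`.  (No `.toCore`: the v1.6 core `Provisos₁₃CoPR` is not on the door road — n07-w3's table has no `Record13CoPR` row — and
  is not re-issued.)
* §3 RECEIPTS `provisos₁₃SepCoPChi_chiβ_iff : θ.Provisos₁₃SepCoPChi (chiβOfRecord₁₃ θ) ↔ θ.Provisos₁₃SepCoP`, `provisos₁₃SepCoPRChi_chiβ_iff` (field for field; every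
  χ-generic parent IS the record's at `χβ` by `rfl`, [Ax-3b∕c∕d] receipts) and the RE-CENTRED instances `abbrev Stage13Params.Provisos₁₃SepCoPAx`,
  `abbrev Stage13RParams.Provisos₁₃SepCoPRAx`.
HONEST SCOPE.  Typed hypotheses (`Prop`-valued structures) and bookkeeping faces; nothing of [III] ∕ [6] ∕ [15] ∕ [IV] ∕ [I] asserted or discharged; no row is
claimed to hold at any θ; K0ᴬ `stmt-QuantumFields-27238` is NOT closed here (door supply only); counts unmoved (typed 28∕28 · discharged 8∕28 · K 1∕4).  One finite
`𝕋⁴` family at fixed `ε` — the route closes the conditional finite-𝕋⁴ rung `BalabanLadder.UV` only; NOT continuum ∕ ℝ⁴ ∕ OS; the Yang–Mills mass gap (Clay) is NOT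
proved.  No `instance`, no `notation`, no `sorry`.
-/

noncomputable section

open MeasureTheory
open scoped Matrix.Norms.L2Operator

namespace Literature.MathematicalPhysics.QuantumFieldTheory.Balaban1983to89.Node00

open T4Continuum AveragingRT T4FiniteEpsInhabited FlowStep FlowStepRuns DagBinding T4DatumAssembly
open B12Eq019ActionBody (integrand)

variable (F : T4Family) (N : ℕ) [NeZero N]

/-! ## §1. `Stage13Params.Provisos₁₃SepCoPChi` — v1.4's separated-range Co-class provisos, generic in the β-slot χ -/

/-- **THE DISPLAYED PROVISOS at `θ : Stage13Params`, Stage 13, ROW P11 ON PRINT'S SEQUENCES AND PRINT'S (7)-REGULAR DATA, AT THE Co-CLASS BACKGROUND OF RECORD,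
GENERIC IN THE β-SLOT χ** (`Node00/Record13SepCoP` §1 `Stage13Params.Provisos₁₃SepCoP` VERBATIM — same rows, same names, same order — along the χ-histories
`gOfRecord₁₃Chi θ χ p` at the χ-thresholds `EOfRecord₁₃Chi θ χ`): rows `intPiece` ∕ `measω` ∕ `measChi` (THEOREMS of (H-U) and the ζ-laws: node00-def-Y `Record13LiveSelectorChi` §0); `zetaUnity`,
`zetaAbs`; def-R's (0.3) provisos `rstep` (INTEGRABLE FORM); the laws `rzLaws`, `ztLaws`, `ztLocal`; the θ-level letters `hM` ([III] p. 245 «M = L^m») and `hM₁`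
(H1 «M₁ ∣ M»); row `bg` = def-R's ranged background proviso `BgProvisoΛ` at the χ-setting `settingOfRecord₁₃Chi θ χ p`, over the separated (7)-regular support
`suppOfRecord₁₃SepCoPChi θ χ p n` ([Ax-3d]) AT the Co-class background `UbgOfRecord₁₃CoPChi θ χ p n` ([Ax-3c]), only along runs whose χ-history stays in the window
`]0, γ]` up to `n ≤ K` and whose 𝐃_j-partitions are compatible with the torus (`PartCompat₁₃Chi θ χ p n`); the (H-ζ) bookkeeping row `zetaMeas` (plain).  At
`χ := chiβOfRecord₁₃ θ` it IS `Provisos₁₃SepCoP` field for field (`provisos₁₃SepCoPChi_chiβ_iff`, §3).  HYPOTHESES, never admissibility clauses, never asserted.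
[cite: Balaban1988Convergent, (2.1) p.254, (2.7) p.255, p.256, (2.18) p.257, (2.21) p.258, (2.28) p.259, (3.2)–(3.9) pp.265–266, (3.16) p.268, (3.20)–(3.21) p.269; Balaban1985RegularSpaces, (1.3)–(1.9) pp.76–77, (7) p.278; Balaban1985Variational, Thm 1 (8) p.279; Balaban1989LargeFieldI, (0.3)–(0.4) p.176; Balaban1987RG1, (0.13) p.254, (0.19) p.255, p.259, (1.2) p.260] -/
structure Stage13Params.Provisos₁₃SepCoPChi (θ : Stage13Params F N) (χ : ChiSlot F N) : Prop where
  /-- the level-`k` pieces `χ_k(s)·slot_k(s)` of `ρ_k` are integrable, `k < K`, along the χ-histories -/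
  intPiece : ∀ (p : B12.RunParams) (k : ℕ), k < p.K → ∀ s : SeqOfRecord F θ.ν θ.τ9.M (gOfRecord₁₃Chi F N θ χ p) p.K k,
    Integrable (fun U => chiSeqOfRecord F N θ.ν θ.τ9.M (gOfRecord₁₃Chi F N θ χ p) p.K k s U *
      slotsOfRecord F N θ.ν θ.τ9 (EOfRecord₁₃Chi F N θ χ) (wOfRecord₉ F N θ.toStage9Params) θ.ppSel p
        (gOfRecord₁₃Chi F N θ χ p) k s U) (fieldMeasure (F.P p.K) k (SU N))
  /-- (O4): the label weights `ω = a·b·ζ` are jointly measurable in `(V′, U)`, `k < K`, along the χ-histories -/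
  measω : ∀ (p : B12.RunParams) (k : ℕ), k < p.K → ∀ (s : SeqOfRecord F θ.ν θ.τ9.M (gOfRecord₁₃Chi F N θ χ p) p.K k)
    (t : LbOfRecord F θ.ν p (gOfRecord₁₃Chi F N θ χ p) k),
    Measurable (fun z : GaugeField (F.P p.K) (k + 1) (SU N) × GaugeField (F.P p.K) k (SU N) =>
      ωOfRecord F N θ.ν θ.τ9.M p (gOfRecord₁₃Chi F N θ χ p) k θ.A₁ θ.ζ s t z.2 z.1)
  /-- the new front factors `χ_{k+1}(s′)` are measurable, `k < K`, along the χ-histories -/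
  measChi : ∀ (p : B12.RunParams) (k : ℕ), k < p.K → ∀ s' : SeqOfRecord F θ.ν θ.τ9.M (gOfRecord₁₃Chi F N θ χ p) p.K (k + 1),
    Measurable (chiSeqOfRecord F N θ.ν θ.τ9.M (gOfRecord₁₃Chi F N θ χ p) p.K (k + 1) s')
  /-- the residual `ζ` resolves unity -/
  zetaUnity : IsZetaUnity F N θ.ν θ.τ9.M θ.ζ
  /-- the residual `ζ` has `Σ |ζ| ≤ 1` -/
  zetaAbs : IsZetaAbsLeOne F N θ.ν θ.τ9.M θ.ζ
  /-- def-R's (0.3) provisos of the pre-𝐑 tower of record, INTEGRABLE FORM (`RepData.ProvisosInt`), at every level `k+1 ≤ K`, along the χ-histories, at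
  every instance -/
  rstep : ∀ (p : B12.RunParams) (k : ℕ) [DecidableEq (PBond (F.P p.K) (k + 1))], k < p.K →
    (towerRepOfRecord F N θ.ν θ.τ9 (slotsTOfRecord F N θ.ν θ.τ9 (EOfRecord₁₃Chi F N θ χ) (wOfRecord₉ F N θ.toStage9Params) θ.ppSel)
      θ.ppSel p (gOfRecord₁₃Chi F N θ χ p) (k + 1)).toRepData.ProvisosInt
  /-- 11c's laws of the residual §2 data -/
  rzLaws : ∀ K, (θ.Rz K).Laws
  /-- 12a's law of the residual part of the 𝐓-weights: `ζ0 ≥ 0` -/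
  ztLaws : ∀ K, (θ.Zt K).Laws
  /-- the locality law of the residual 𝐓-weight factor -/
  ztLocal : ∀ K, (θ.Zt K).LocalLaws
  /-- [III] p. 245 «M = L^m is sufficiently large»: the 𝐑-operation cube side `M` is a POWER OF `L` (θ-level letter of print; with `Odd L` it excludes
  `4 ∣ M`, under which `PartCompat₁₃Chi θ χ p n` fails for every `n ≥ 1` and row `bg` idles) -/
  hM : ∃ a : ℕ, θ.τ9.M = F.L ^ a
  /-- [III] p. 245 «M₁ = L^{m₁}, M₂ = L^{m₂}, M₁ < M₂ < M» read as the DIVISIBILITY letter H1 of HYP-AUDIT-13: the layer width `M₁` of the (2.13) determining sets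
  divides the 𝐑-cube side `M`, hence every 𝐃_j-cube side `L^j·M·R_j` (θ-level, run-free; `M₁_dvd_dCubeSide`) -/
  hM₁ : θ.ν.M₁ ∣ θ.τ9.M
  /-- p. 259, ON PRINT'S RANGES AND PRINT'S SEQUENCES: the Co-CLASS background of record at χ, `UbgOfRecord₁₃CoPChi θ χ`, lies in `U^c_j(X, α_{0,j}, α_{1,j})` for the
  domains `X ⊂ Λ_j(s)` of the (2.26)–(2.27) ∕ (2.30) sums and the (2.41)(i) range, on the regular retained configurations AT SEPARATED (2.18) indices `s`
  ([6] (1.3)–(1.6)) — every run whose χ-history stays in the window `]0, γ]` up to the length `n ≤ K` AND whose 𝐃_j-partitions, `1 ≤ j ≤ n`, are compatible with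
  the torus ([III] p. 257; `PartCompat₁₃Chi`) -/
  bg : ∀ (p : B12.RunParams) (n : ℕ), n ≤ p.K → Step.InInterval θ.γ n (gOfRecord₁₃Chi F N θ χ p) → PartCompat₁₃Chi F N θ χ p n →
    BgProvisoΛ F N p.K (settingOfRecord₁₃Chi F N θ χ p) (θ.Rz p.K) θ.τ9.M n (suppOfRecord₁₃SepCoPChi F N θ χ p n) (UbgOfRecord₁₃CoPChi F N θ χ p n)
  /-- **(H-ζ) ROW**: the residual fluctuation factor `ζ` of the record is jointly measurable in the old and new fields (RECORD 12 measurability; a plain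
  required row — the source's `autoParam` default is a construction-site filler, not part of the statement) -/
  zetaMeas : ZetaMeasurable F N θ.ζ

variable {F N}

/-- The χ-generic separated-range provisos PROJECT to the χ-generic core (drop `hM`, `hM₁`, `bg`). [cite: Balaban1988Convergent, (2.18) p.257 (bookkeeping)] -/
theorem Stage13Params.Provisos₁₃SepCoPChi.toCore {θ : Stage13Params F N} {χ : ChiSlot F N} (h : θ.Provisos₁₃SepCoPChi F N χ) :
    θ.Provisos₁₃CoreChi F N χ where
  zetaMeas := h.zetaMeas
  intPiece := h.intPiece
  measω := h.measω
  measChi := h.measChi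
  zetaUnity := h.zetaUnity
  zetaAbs := h.zetaAbs
  rstep := fun p k _ hk => h.rstep p k hk
  rzLaws := h.rzLaws
  ztLaws := h.ztLaws
  ztLocal := h.ztLocal

/-- **`M` IS ODD**: `M = L^a` with `L` odd (`T4Family.hL`). [cite: Balaban1988Convergent, p.245 (bookkeeping)] -/
theorem Stage13Params.Provisos₁₃SepCoPChi.odd_M {θ : Stage13Params F N} {χ : ChiSlot F N} (h : θ.Provisos₁₃SepCoPChi F N χ) : Odd θ.τ9.M := by
  obtain ⟨a, ha⟩ := h.hM
  rw [ha]
  exact F.hL.1.pow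

/-- **THE ANTI-DODGE CERTIFICATE `¬ 4 ∣ M`**: the hypothesis `4 ∣ M` of the `PartCompat` dodge contradicts the field `hM`. [cite: Balaban1988Convergent, p.245, p.257 (bookkeeping)] -/
theorem Stage13Params.Provisos₁₃SepCoPChi.not_four_dvd_M {θ : Stage13Params F N} {χ : ChiSlot F N} (h : θ.Provisos₁₃SepCoPChi F N χ) : ¬ 4 ∣ θ.τ9.M :=
  fun h4 => (Nat.not_even_iff_odd.mpr h.odd_M) (even_iff_two_dvd.mpr (dvd_trans (by norm_num : (2 : ℕ) ∣ 4) h4))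

/-- **H1 AT EVERY 𝐃_j-CUBE**: `M₁ ∣ L^j·M·R_j` = `dCubeSide L M R_j j` for every `L`, `R_j`, `j`. [cite: Balaban1985RegularSpaces, (1) p.277; Balaban1988Convergent, (2.1) p.254, (2.13) p.256 (bookkeeping)] -/
theorem Stage13Params.Provisos₁₃SepCoPChi.M₁_dvd_dCubeSide {θ : Stage13Params F N} {χ : ChiSlot F N} (h : θ.Provisos₁₃SepCoPChi F N χ) (L R j : ℕ) :
    θ.ν.M₁ ∣ dCubeSide L θ.τ9.M R j :=
  (Dvd.dvd.mul_left h.hM₁ (L ^ j)).mul_right R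

/-- The weight laws of the run FROM the χ-generic provisos (the P-weights do not read the β-slot). [cite: Balaban1988Convergent, (2.21) p.258 (bookkeeping)] -/
theorem Stage13Params.Provisos₁₃SepCoPChi.wtLaws {θ : Stage13Params F N} {χ : ChiSlot F N} (h : θ.Provisos₁₃SepCoPChi F N χ) (p : B12.RunParams) :
    (WtOfRecord₁₃P F N θ p).Laws :=
  WtOfRecord₁₃P_laws h.ztLaws p

/-- **def-T's step provisos FROM the χ-generic Stage-13 provisos** at every step `k < K`, along the χ-histories (`Provisos₁₃SepCoP.tstep` verbatim).
[cite: Balaban1988Convergent, (3.2)–(3.9) pp.265–266, (3.16) p.268, (3.24)–(3.25) p.270] -/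
theorem Stage13Params.Provisos₁₃SepCoPChi.tstep {θ : Stage13Params F N} {χ : ChiSlot F N} (h : θ.Provisos₁₃SepCoPChi F N χ) (p : B12.RunParams) (k : ℕ)
    (hk : k < p.K) :
    TStepProvisos F N θ.ν θ.τ9 (EOfRecord₁₃Chi F N θ χ) (wOfRecord₉ F N θ.toStage9Params) θ.ppSel p
      (gOfRecord₁₃Chi F N θ χ p) k :=
  h.toCore.tstep p k hk

variable (F N)

/-! ## §2. `Stage13RParams.Provisos₁₃SepCoPRChi` — v1.6's separated-range Co-class provisos over the run-indexed residual 𝐓-weight slot, generic in χ -/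

/-- **THE DISPLAYED PROVISOS at `θ : Stage13RParams`, Stage 13, ROW P11 ON PRINT'S SEQUENCES AND PRINT'S (7)-REGULAR DATA, AT THE Co-CLASS BACKGROUND OF RECORD,
OVER THE RUN-INDEXED RESIDUAL 𝐓-WEIGHT SLOT, GENERIC IN THE β-SLOT χ** (`Node00/Record13SepCoPR` §1 `Stage13RParams.Provisos₁₃SepCoPR` VERBATIM — same rows, same
names, same order — every Record13-level object read at `θ.toStage13Params` along the χ-histories `gOfRecord₁₃Chi θ.toStage13Params χ p`): the rows of §1's
`Provisos₁₃SepCoPChi` except that 12a's two rows on the RUN-BLIND slot `ztLaws ∕ ztLocal` are REPLACED by `zrLaws : ∀ p, (θ.Zr p).Laws` ∕ `zrLocal : ∀ p, (θ.Zr p).LocalLaws`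
on the RUN-INDEXED slot `θ.Zr`; row `bg` UNCHANGED (it does not read the residual 𝐓-weight slot).  At `χ := chiβOfRecord₁₃ θ.toStage13Params` it IS `Provisos₁₃SepCoPR`
field for field (`provisos₁₃SepCoPRChi_chiβ_iff`, §3).  HYPOTHESES, never admissibility clauses, never asserted.
[cite: Balaban1988Convergent, (1.11) p.248, (2.1) p.254, (2.7) p.255, p.256, (2.18) p.257, (2.21) p.258, (2.28) p.259, (3.2)–(3.9) pp.265–266, (3.16) p.268, (3.20)–(3.21) p.269; Balaban1985RegularSpaces, (1.3)–(1.9) pp.76–77, (7) p.278; Balaban1985Variational, Thm 1 (8) p.279; Balaban1989LargeFieldI, (0.3)–(0.4) p.176; Balaban1987RG1, (0.13) p.254, (0.19) p.255, p.259, (1.2) p.260] -/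
structure Stage13RParams.Provisos₁₃SepCoPRChi (θ : Stage13RParams F N) (χ : ChiSlot F N) : Prop where
  /-- the level-`k` pieces `χ_k(s)·slot_k(s)` of `ρ_k` are integrable, `k < K`, along the χ-histories -/
  intPiece : ∀ (p : B12.RunParams) (k : ℕ), k < p.K → ∀ s : SeqOfRecord F θ.ν θ.τ9.M (gOfRecord₁₃Chi F N θ.toStage13Params χ p) p.K k,
    Integrable (fun U => chiSeqOfRecord F N θ.ν θ.τ9.M (gOfRecord₁₃Chi F N θ.toStage13Params χ p) p.K k s U *
      slotsOfRecord F N θ.ν θ.τ9 (EOfRecord₁₃Chi F N θ.toStage13Params χ) (wOfRecord₉ F N θ.toStage9Params) θ.ppSel p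
        (gOfRecord₁₃Chi F N θ.toStage13Params χ p) k s U) (fieldMeasure (F.P p.K) k (SU N))
  /-- (O4): the label weights `ω = a·b·ζ` are jointly measurable in `(V′, U)`, `k < K`, along the χ-histories -/
  measω : ∀ (p : B12.RunParams) (k : ℕ), k < p.K → ∀ (s : SeqOfRecord F θ.ν θ.τ9.M (gOfRecord₁₃Chi F N θ.toStage13Params χ p) p.K k)
    (t : LbOfRecord F θ.ν p (gOfRecord₁₃Chi F N θ.toStage13Params χ p) k),
    Measurable (fun z : GaugeField (F.P p.K) (k + 1) (SU N) × GaugeField (F.P p.K) k (SU N) =>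
      ωOfRecord F N θ.ν θ.τ9.M p (gOfRecord₁₃Chi F N θ.toStage13Params χ p) k θ.A₁ θ.ζ s t z.2 z.1)
  /-- the new front factors `χ_{k+1}(s′)` are measurable, `k < K`, along the χ-histories -/
  measChi : ∀ (p : B12.RunParams) (k : ℕ), k < p.K → ∀ s' : SeqOfRecord F θ.ν θ.τ9.M (gOfRecord₁₃Chi F N θ.toStage13Params χ p) p.K (k + 1),
    Measurable (chiSeqOfRecord F N θ.ν θ.τ9.M (gOfRecord₁₃Chi F N θ.toStage13Params χ p) p.K (k + 1) s')
  /-- the residual `ζ` resolves unity -/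
  zetaUnity : IsZetaUnity F N θ.ν θ.τ9.M θ.ζ
  /-- the residual `ζ` has `Σ |ζ| ≤ 1` -/
  zetaAbs : IsZetaAbsLeOne F N θ.ν θ.τ9.M θ.ζ
  /-- def-R's (0.3) provisos of the pre-𝐑 tower of record, INTEGRABLE FORM (`RepData.ProvisosInt`), at every level `k+1 ≤ K`, along the χ-histories, at
  every instance -/
  rstep : ∀ (p : B12.RunParams) (k : ℕ) [DecidableEq (PBond (F.P p.K) (k + 1))], k < p.K →
    (towerRepOfRecord F N θ.ν θ.τ9 (slotsTOfRecord F N θ.ν θ.τ9 (EOfRecord₁₃Chi F N θ.toStage13Params χ) (wOfRecord₉ F N θ.toStage9Params) θ.ppSel)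
      θ.ppSel p (gOfRecord₁₃Chi F N θ.toStage13Params χ p) (k + 1)).toRepData.ProvisosInt
  /-- 11c's laws of the residual §2 data -/
  rzLaws : ∀ K, (θ.Rz K).Laws
  /-- (v1.6 · RUN-INDEXED) 12a's law of the residual part of the 𝐓-weights OF THE RUN: `ζ0 ≥ 0` -/
  zrLaws : ∀ p, (θ.Zr p).Laws
  /-- (v1.6 · RUN-INDEXED) the locality law of the residual 𝐓-weight factor OF THE RUN -/
  zrLocal : ∀ p, (θ.Zr p).LocalLaws
  /-- [III] p. 245 «M = L^m is sufficiently large»: the 𝐑-operation cube side `M` is a POWER OF `L` -/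
  hM : ∃ a : ℕ, θ.τ9.M = F.L ^ a
  /-- [III] p. 245, the DIVISIBILITY letter H1 of HYP-AUDIT-13: `M₁ ∣ M` -/
  hM₁ : θ.ν.M₁ ∣ θ.τ9.M
  /-- p. 259, ON PRINT'S RANGES AND PRINT'S SEQUENCES: the Co-CLASS background of record at χ lies in `U^c_j(X, α_{0,j}, α_{1,j})` on the regular retained
  configurations AT SEPARATED (2.18) indices — every run whose χ-history stays in the window `]0, γ]` up to `n ≤ K` AND whose 𝐃_j-partitions are compatible with
  the torus (`PartCompat₁₃Chi`) -/
  bg : ∀ (p : B12.RunParams) (n : ℕ), n ≤ p.K → Step.InInterval θ.γ n (gOfRecord₁₃Chi F N θ.toStage13Params χ p) → PartCompat₁₃Chi F N θ.toStage13Params χ p n →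
    BgProvisoΛ F N p.K (settingOfRecord₁₃Chi F N θ.toStage13Params χ p) (θ.Rz p.K) θ.τ9.M n (suppOfRecord₁₃SepCoPChi F N θ.toStage13Params χ p n)
      (UbgOfRecord₁₃CoPChi F N θ.toStage13Params χ p n)
  /-- **(H-ζ) ROW**: the residual fluctuation factor `ζ` of the record is jointly measurable in the old and new fields (plain required row) -/
  zetaMeas : ZetaMeasurable F N θ.ζ

variable {F N}

/-- **`M` IS ODD**: `M = L^a` with `L` odd. [cite: Balaban1988Convergent, p.245 (bookkeeping)] -/
theorem Stage13RParams.Provisos₁₃SepCoPRChi.odd_M {θ : Stage13RParams F N} {χ : ChiSlot F N} (h : θ.Provisos₁₃SepCoPRChi F N χ) : Odd θ.τ9.M := by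
  obtain ⟨a, ha⟩ := h.hM
  rw [ha]
  exact F.hL.1.pow

/-- **THE ANTI-DODGE CERTIFICATE `¬ 4 ∣ M`** at the `R` level. [cite: Balaban1988Convergent, p.245, p.257 (bookkeeping)] -/
theorem Stage13RParams.Provisos₁₃SepCoPRChi.not_four_dvd_M {θ : Stage13RParams F N} {χ : ChiSlot F N} (h : θ.Provisos₁₃SepCoPRChi F N χ) : ¬ 4 ∣ θ.τ9.M :=
  fun h4 => (Nat.not_even_iff_odd.mpr h.odd_M) (even_iff_two_dvd.mpr (dvd_trans (by norm_num : (2 : ℕ) ∣ 4) h4))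

/-- **H1 AT EVERY 𝐃_j-CUBE** at the `R` level. [cite: Balaban1985RegularSpaces, (1) p.277; Balaban1988Convergent, (2.1) p.254, (2.13) p.256 (bookkeeping)] -/
theorem Stage13RParams.Provisos₁₃SepCoPRChi.M₁_dvd_dCubeSide {θ : Stage13RParams F N} {χ : ChiSlot F N} (h : θ.Provisos₁₃SepCoPRChi F N χ) (L R j : ℕ) :
    θ.ν.M₁ ∣ dCubeSide L θ.τ9.M R j :=
  (Dvd.dvd.mul_left h.hM₁ (L ^ j)).mul_right R

/-- The weight laws of the run FROM the χ-generic `R` provisos (the run-indexed weights `WtOfRecord₁₃R` do not read the β-slot). [cite: Balaban1988Convergent, (2.21) p.258 (bookkeeping)] -/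
theorem Stage13RParams.Provisos₁₃SepCoPRChi.wtLaws {θ : Stage13RParams F N} {χ : ChiSlot F N} (h : θ.Provisos₁₃SepCoPRChi F N χ) (p : B12.RunParams) :
    (WtOfRecord₁₃R F N θ p).Laws :=
  WtOfRecord₁₃R_laws h.zrLaws p

/-- **def-T's step provisos FROM the χ-generic `R` provisos** at every step `k < K`, along the χ-histories (`Provisos₁₃SepCoPR.tstep` verbatim).
[cite: Balaban1988Convergent, (3.2)–(3.9) pp.265–266, (3.16) p.268, (3.24)–(3.25) p.270] -/
theorem Stage13RParams.Provisos₁₃SepCoPRChi.tstep {θ : Stage13RParams F N} {χ : ChiSlot F N} (h : θ.Provisos₁₃SepCoPRChi F N χ) (p : B12.RunParams) (k : ℕ)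
    (hk : k < p.K) :
    TStepProvisos F N θ.ν θ.τ9 (EOfRecord₁₃Chi F N θ.toStage13Params χ) (wOfRecord₉ F N θ.toStage9Params) θ.ppSel p
      (gOfRecord₁₃Chi F N θ.toStage13Params χ p) k where
  intPiece := h.intPiece p k hk
  measW := fun s' => measurable_wOfRecord F N θ.ν θ.τ9.M θ.A₁ θ.ζ p (gOfRecord₁₃Chi F N θ.toStage13Params χ p) k (h.measω p k hk) s'
  absW_le := fun s' U V' => abs_wOfRecord_le_one F N θ.ν θ.τ9.M θ.A₁ h.zetaAbs p (gOfRecord₁₃Chi F N θ.toStage13Params χ p) k s' U V'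
  measChi := h.measChi p k hk
  unity := isStepUnity_wOfRecord F N θ.ν θ.τ9.M θ.A₁ h.zetaUnity p (gOfRecord₁₃Chi F N θ.toStage13Params χ p) k

/-! ## §3. Receipts at the record's β-slot and the re-centred instances -/

section Receipts

/-- Receipt: the χ-generic v1.4 separated-range Co-class provisos at the record's β-slot are the record's, field for field. [cite: Balaban1988Convergent, (2.18) p.257, (2.28) p.259 (bookkeeping)] -/
theorem provisos₁₃SepCoPChi_chiβ_iff (θ : Stage13Params F N) : θ.Provisos₁₃SepCoPChi F N (chiβOfRecord₁₃ F N θ) ↔ θ.Provisos₁₃SepCoP F N :=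
  ⟨fun h => ⟨h.intPiece, h.measω, h.measChi, h.zetaUnity, h.zetaAbs, h.rstep, h.rzLaws, h.ztLaws, h.ztLocal, h.hM, h.hM₁, h.bg, h.zetaMeas⟩,
   fun h => ⟨h.intPiece, h.measω, h.measChi, h.zetaUnity, h.zetaAbs, h.rstep, h.rzLaws, h.ztLaws, h.ztLocal, h.hM, h.hM₁, h.bg, h.zetaMeas⟩⟩

/-- Receipt: the χ-generic v1.6 `R` provisos at the record's β-slot are the record's, field for field. [cite: Balaban1988Convergent, (2.18) p.257, (2.28) p.259 (bookkeeping)] -/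
theorem provisos₁₃SepCoPRChi_chiβ_iff (θ : Stage13RParams F N) :
    θ.Provisos₁₃SepCoPRChi F N (chiβOfRecord₁₃ F N θ.toStage13Params) ↔ θ.Provisos₁₃SepCoPR F N :=
  ⟨fun h => ⟨h.intPiece, h.measω, h.measChi, h.zetaUnity, h.zetaAbs, h.rstep, h.rzLaws, h.zrLaws, h.zrLocal, h.hM, h.hM₁, h.bg, h.zetaMeas⟩,
   fun h => ⟨h.intPiece, h.measω, h.measChi, h.zetaUnity, h.zetaAbs, h.rstep, h.rzLaws, h.zrLaws, h.zrLocal, h.hM, h.hM₁, h.bg, h.zetaMeas⟩⟩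

/-- Receipt: the core projection commutes with the receipts (proof-irrelevant bookkeeping). [cite: Balaban1988Convergent, (2.18) p.257 (bookkeeping)] -/
theorem provisos₁₃SepCoPChi_chiβ_toCore (θ : Stage13Params F N) (h : θ.Provisos₁₃SepCoP F N) :
    (provisos₁₃CoreChi_chiβ_iff θ).1 ((provisos₁₃SepCoPChi_chiβ_iff θ).2 h).toCore = h.toCore := rfl

end Receipts

variable (F N)

/-- **The v1.4 separated-range Co-class provisos, RE-CENTRED** (instance `χ := chiβOfRecord₁₃Ax θ`, [Ax-3a]). [cite: Balaban1988Convergent, (2.18) p.257, (2.28) p.259, (3.16) p.268] -/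
abbrev Stage13Params.Provisos₁₃SepCoPAx (θ : Stage13Params F N) : Prop := θ.Provisos₁₃SepCoPChi F N (chiβOfRecord₁₃Ax F N θ)

/-- **The v1.6 `R` separated-range Co-class provisos, RE-CENTRED** (instance `χ := chiβOfRecord₁₃Ax θ.toStage13Params`). [cite: Balaban1988Convergent, (2.18) p.257, (2.28) p.259, (3.16) p.268] -/
abbrev Stage13RParams.Provisos₁₃SepCoPRAx (θ : Stage13RParams F N) : Prop := θ.Provisos₁₃SepCoPRChi F N (chiβOfRecord₁₃Ax F N θ.toStage13Params)

end Literature.MathematicalPhysics.QuantumFieldTheory.Balaban1983to89.Node00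

end
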